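import Literature.NumberTheory.GaloisCohomology.Howard2004.TransverseIsotropyProofs
import Literature.NumberTheory.GaloisCohomology.Howard2004.DualityDatumLocalCupScalarReadingFlipProofs
import Literature.NumberTheory.GaloisCohomology.Howard2004.TransportConnectingKernelProofs
import Literature.NumberTheory.GaloisCohomology.Howard2004.RelaxedSelmerIsotropyProofs
import Literature.NumberTheory.GaloisCohomology.PoitouTateSelmerCountProofs
import HarnessLib

/-!
# Howard 2004, H.4 from isotropy and a count: a local condition that is ISOTROPIC under the induced pairing and
# has complementary size is its own EXACT orthogonal complement (`IsSelfOrthogonalAt`) — proofs file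

Topic `NumberTheory/GaloisCohomology/Howard2004`. THEOREMS ONLY: no definition, no named fact, no instance, no
notation, no `sorry`. Cell `pub/bsd-print-x9`, print leaf G87
`Literature.NumberTheory.GaloisCohomology.Howard2004.thm161_dvrKolyvaginBound` (Howard Thm. 1.6.1); seat
`bsd-line-x9-p1-w4` g16, brick (H4-OF-ISO); sequel to `TransverseIsotropyProofs` and
`RelaxedSelmerLagrangianCountProofs`.

SOURCE / WHY. B. Howard, *The Heegner point Kolyvagin system*, Compositio Math. **140** (2004) = arXiv:1202.6340,
§1.3 H.4 (p. 7 L78–82): «the local condition `𝓕` is its own exact orthogonal complement under the induced local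
pairing» — required at EVERY place of `Σ(𝓕(n))`, in particular (Remark after Def. 1.2.2 / Lemma 1.5.6, p. 10 L86–88:
«`𝓕^m(n)` is maximal isotropic away from `m`») for the TRANSVERSE condition at the primes `λ ∣ n` and the
unramified condition elsewhere.  In print this is «`H¹_f` and `H¹_tr` are each maximal isotropic» (Prop. 1.1.9 +
local Tate duality); in the tree the two halves are (i) ISOTROPY (`UnramifiedIsotropy`, `TransverseIsotropyProofs`) and
(ii) the COUNT `#𝓕_v · #𝓕_{σv} = #H¹(K_v, T)` (Prop. 1.1.9: `H¹ = H¹_f ⊕ H¹_tr`, each `≅ T`).  This file proves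
(i) + (ii) ⇒ H.4 (`DualityDatum.IsSelfOrthogonalAt`), by counting annihilators under the PERFECT `ℤ/p^k`-reading of
`∪_e` (Milne I Cor. 2.3, tree `natCard_annihilator_mul_natCard`).

WHAT IS PROVED (`T` finite killed by `p^k`, `(λ, exp)` as in `DualityDatumTateDualBridge`, `Θ = D.toTateDual λ exp`
bijective, `inv` with `IsPerfect`):
* §1 **`DualityDatum.isSelfOrthogonalAt_of_isotropic_of_card`**: for a Selmer structure `𝓕` and a finite place `v`,
  if `x ∪_e y = 0` for `x ∈ 𝓕_v`, `y ∈ transport_v(𝓕_{σv})` (isotropy) and `#𝓕_v · #𝓕_{σv} = #H¹(K_v, T)` (count),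
  then `D.IsSelfOrthogonalAt 𝓕 v` (both exactness clauses): `𝓕_v` sits inside the reading-annihilator `U` of
  `X = transport_v(𝓕_{σv})`, `#U · #X = #H¹(K_v, Tw T) = #H¹(K_v, T)` (perfect reading), so `#U = #𝓕_v` and `U = 𝓕_v`;
  symmetrically for `X` with the flipped reading.
* §2 **`DualityDatum.isSelfOrthogonalAt_of_transverse`**: H.4 at a prime `λ ∣ n` for a structure whose components at
  `v`, `σ v` are the transverse conditions, from `TransverseIsotropyProofs.forall_localCup_eq_zero_of_transverse` and the
  count `#H¹_tr(K_v, T) · #H¹_tr(K_{σv}, T) = #H¹(K_v, T)` (hypothesis; Prop. 1.1.9).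
* §3 `isSelfOrthogonalAt_congr`, **`isSelfOrthogonal_of_eq_off`**: H.4 for a structure `𝓖` agreeing with an H.4 structure
  `𝓕` outside a `σ`-stable set `P` of finite places and self-orthogonal on `P` (Howard's `𝓕(n)`) — the `horth` input of
  `RelaxedSelmerSelfAnnihilatorProofs`.

NOT HERE: the counts themselves (x9-p1-w3's Prop 1.1.9 files), the unramified case's count (local Euler characteristic);
`thm161_dvrKolyvaginBound` is NOT proved; no summit statement is proved; the Birch–Swinnerton-Dyer conjecture is not
proved by any of this.
References: [Howard2004HeegnerKolyvagin] §1.3 H.4, Prop. 1.1.9, Def. 1.2.2, Lemma 1.5.6; [MilneADT2006] I Prop. 0.19, I Cor. 2.3.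
-/

set_option autoImplicit false

noncomputable section

open CategoryTheory Function NumberField IsDedekindDomain Field
open scoped NumberField

namespace Literature.NumberTheory.GaloisCohomology.Howard2004

open Literature.NumberTheory.GaloisRepresentations
open Literature.NumberTheory.GaloisRepresentations.DiscreteGaloisModule

variable {K : Type} [Field K] [NumberField K] {M : Type} [AddCommGroup M] [TopologicalSpace M]
  [DiscreteTopology M] {R : Type} [CommRing R] [Module R M] [TopologicalSpace R] [DiscreteTopology R]
  {p : ℕ} [Fact p.Prime] [Algebra ℤ_[p] R] {cd : ConjugationDatum K} {ρ : DiscreteGaloisModule K M}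
  [Finite M] (D : DualityDatum p cd ρ R) {k : ℕ}
  (lam : R →+ ZMod (p ^ k))
  (hlam : ∀ (z : ℤ_[p]) (r : R), lam (algebraMap ℤ_[p] R z * r) = PadicInt.toZModPow k z * lam r)
  (exp : ZMod (p ^ k) →+ MuCarrier K (p ^ k))
  (hexp : ∀ (g : absoluteGaloisGroup K) (x : ZMod (p ^ k)),
    exp (cyclotomicCharacterModPow K p k g * x) = mu K (p ^ k) g (exp x))

namespace DualityDatum

/-! ## §1 Isotropy + the count `#𝓕_v · #𝓕_{σv} = #H¹(K_v, T)` ⇒ H.4 at `v` -/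

include hlam hexp in
/-- **H.4 from isotropy and a count.**  Let `𝓕` be a family of local conditions and `v` a finite place such that
(isotropy) `x ∪_e y = 0` for all `x ∈ 𝓕_v`, `y ∈ transport_v(𝓕_{σ v})`, and (count) `#𝓕_v · #𝓕_{σv} = #H¹(K_v, T)`.
Then `𝓕_v` and `transport_v(𝓕_{σv})` are EXACT annihilators of each other under `∪_e` (`IsSelfOrthogonalAt`): both
sit inside the corresponding annihilators for the perfect `ℤ/p^k`-reading `inv_v H²(exp ∘ λ)(· ∪_e ·)`, whose orders are
`#H¹/#𝓕_{σv} = #𝓕_v` resp. `#H¹/#𝓕_v = #𝓕_{σv}` (Milne I Prop. 0.19).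
[cite: Howard2004HeegnerKolyvagin, §1.3 H.4 (arXiv p. 7 L78–82: «its own exact orthogonal complement») and Lemma 1.5.6 (p. 10 L86–88)] [cite: MilneADT2006, Ch. I Prop. 0.19 and Cor. 2.3] -/
theorem isSelfOrthogonalAt_of_isotropic_of_card (hn : ∀ m : M, (p ^ k) • m = 0)
    (hΘ : Bijective (D.toTateDual lam hlam exp hexp)) (inv : LocalInvariants K (p ^ k)) (hperf : inv.IsPerfect)
    (𝓕 : SelmerStructure ρ) (v : HeightOneSpectrum (𝓞 K))
    (hiso : ∀ x ∈ 𝓕 (Sum.inr v), ∀ y ∈ (𝓕 (Sum.inr (cd.σ • v))).map (cd.transportH1 ρ v),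
      D.localCup (Sum.inr v) x y = 0)
    (hcard : Nat.card (𝓕 (Sum.inr v)) * Nat.card (𝓕 (Sum.inr (cd.σ • v))) =
      Nat.card (galoisCohomology (ρ.toLocal (Sum.inr v)) 1)) :
    D.IsSelfOrthogonalAt 𝓕 v := by
  haveI : NeZero (p ^ k) := ⟨pow_ne_zero k (Fact.out : p.Prime).ne_zero⟩
  haveI := finite_galoisCohomology_one_toLocal ρ v
  haveI := finite_galoisCohomology_one_toLocal (cd.twist ρ) v
  -- the perfect reading pairing `b(x, y) = inv_v H²(exp ∘ λ)(x ∪_e y)`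
  obtain ⟨b, hb_def⟩ : ∃ b : galoisCohomology (ρ.toLocal (Sum.inr v)) 1 →+
      galoisCohomology ((cd.twist ρ).toLocal (Sum.inr v)) 1 →+ ZMod (p ^ k),
      b = (localTatePairingZMod ρ (p ^ k) (Sum.inr v) (inv (Sum.inr v))).compl₂
        (galoisCohomology.map (EllipticCurves.DiscreteGaloisModule.localMap (D.toTateDual lam hlam exp hexp)
          (Sum.inr v)) 1) := ⟨_, rfl⟩
  have hb_apply : ∀ x y, b x y = inv (Sum.inr v) (cohomologyMap (D.expLamLocalHom lam hlam exp hexp (Sum.inr v)) 2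
      (D.localCup (Sum.inr v) x y)) := fun x y => by
    rw [hb_def, AddMonoidHom.compl₂_apply, localTatePairingZMod_apply,
      D.cohomologyMap_localCup_eq_localTatePairing lam hlam exp hexp]
  have hιL := ((hperf v).2 ρ hn).1.1
  have hιR := ((hperf v).2 ρ hn).2.1
  have hb : Bijective b := by
    refine ⟨?_, fun χ => ?_⟩
    · rw [hb_def]; exact D.injective_localCupZMod lam hlam exp hexp hΘ (Sum.inr v) (inv (Sum.inr v)) hιL
    · obtain ⟨x, hx⟩ := D.exists_forall_reading_localCup_eq_flip lam hlam exp hexp hn hΘ v (inv (Sum.inr v)) hιL hιR χ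
      exact ⟨x, AddMonoidHom.ext fun y => by rw [hb_apply, hx y]⟩
  have hb' : Bijective b.flip := by
    refine ⟨?_, fun χ => ?_⟩
    · rw [hb_def]; exact D.injective_localCupZMod_flip lam hlam exp hexp hΘ (Sum.inr v) (inv (Sum.inr v)) hιR
    · obtain ⟨y, hy⟩ := D.exists_forall_reading_localCup_eq lam hlam exp hexp hn hΘ v (inv (Sum.inr v)) hιL hιR χ
      exact ⟨y, AddMonoidHom.ext fun x => by rw [AddMonoidHom.flip_apply, hb_apply, hy x]⟩
  have hA : ∀ x : galoisCohomology (ρ.toLocal (Sum.inr v)) 1, (p ^ k) • x = 0 :=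
    fun x => galoisCohomology.nsmul_eq_zero_of_forall _ hn x
  have hB : ∀ y : galoisCohomology ((cd.twist ρ).toLocal (Sum.inr v)) 1, (p ^ k) • y = 0 :=
    fun y => galoisCohomology.nsmul_eq_zero_of_forall _ hn y
  -- readings vanish where `∪_e` does
  have hread0 : ∀ x y, D.localCup (Sum.inr v) x y = 0 → b x y = 0 := fun x y h => by
    rw [hb_apply, h]; exact (congrArg (inv (Sum.inr v)) (map_zero _)).trans (map_zero _)
  -- the two objects
  set F := 𝓕 (Sum.inr v) with hF
  set X := (𝓕 (Sum.inr (cd.σ • v))).map (cd.transportH1 ρ v) with hX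
  have hXcard : Nat.card X = Nat.card (𝓕 (Sum.inr (cd.σ • v))) :=
    AddSubgroup.card_map_of_injective (cd.transportH1_injective ρ v)
  have hAB : Nat.card (galoisCohomology (ρ.toLocal (Sum.inr v)) 1) =
      Nat.card (galoisCohomology ((cd.twist ρ).toLocal (Sum.inr v)) 1) := natCard_eq_of_bijective hB b hb
  have hFpos : 0 < Nat.card F := Nat.card_pos
  have hXpos : 0 < Nat.card X := Nat.card_pos
  -- the reading annihilators
  let U : AddSubgroup (galoisCohomology (ρ.toLocal (Sum.inr v)) 1) :=
    { carrier := {x | ∀ y ∈ X, b x y = 0}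
      zero_mem' := fun y _ => by rw [map_zero, AddMonoidHom.zero_apply]
      add_mem' := fun {x x'} hx hx' y hy => by rw [map_add, AddMonoidHom.add_apply, hx y hy, hx' y hy, add_zero]
      neg_mem' := fun {x} hx y hy => by rw [map_neg, AddMonoidHom.neg_apply, hx y hy, neg_zero] }
  let V : AddSubgroup (galoisCohomology ((cd.twist ρ).toLocal (Sum.inr v)) 1) :=
    { carrier := {y | ∀ x ∈ F, b x y = 0}
      zero_mem' := fun x _ => by rw [map_zero]
      add_mem' := fun {y y'} hy hy' x hx => by rw [map_add, hy x hx, hy' x hx, add_zero]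
      neg_mem' := fun {y} hy x hx => by rw [map_neg, hy x hx, neg_zero] }
  have hFU : F ≤ U := fun x hx y hy => hread0 x y (hiso x hx y hy)
  have hXV : X ≤ V := fun y hy x hx => hread0 x y (hiso x hx y hy)
  have hUcount : Nat.card U * Nat.card X = Nat.card (galoisCohomology ((cd.twist ρ).toLocal (Sum.inr v)) 1) :=
    natCard_annihilator_mul_natCard hB b hb X U fun _ => Iff.rfl
  have hVcount : Nat.card V * Nat.card F = Nat.card (galoisCohomology (ρ.toLocal (Sum.inr v)) 1) :=
    natCard_annihilator_mul_natCard hA b.flip hb' F V fun y => by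
      simp only [AddMonoidHom.flip_apply]; exact Iff.rfl
  rw [hXcard] at hUcount
  have hUF : Nat.card U = Nat.card F :=
    Nat.eq_of_mul_eq_mul_right (hXcard ▸ hXpos) (by rw [hUcount, ← hAB, ← hcard])
  have hVX : Nat.card V = Nat.card X :=
    Nat.eq_of_mul_eq_mul_right hFpos (by rw [hVcount, ← hcard, hXcard, mul_comm])
  have hUeq : U = F := (AddSubgroup.eq_of_le_of_card_ge hFU hUF.le).symm
  have hVeq : V = X := (AddSubgroup.eq_of_le_of_card_ge hXV hVX.le).symm
  refine ⟨fun x => ⟨fun hx y hy => hiso x hx y hy, fun h => ?_⟩, fun y => ⟨fun hy x hx => hiso x hx y hy, fun h => ?_⟩⟩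
  · have hxU : x ∈ U := fun y hy => hread0 x y (h y hy)
    rw [hUeq] at hxU
    exact hxU
  · have hyV : y ∈ V := fun x hx => hread0 x y (h x hx)
    rw [hVeq] at hyV
    exact hyV

/-! ## §2 H.4 at a prime `λ ∣ n` for the transverse conditions -/

include hlam hexp in
/-- **H.4 for the transverse condition at an inert Kolyvagin prime** (`IsSelfOrthogonalAt` for a structure whose
components at `v` and `σ v` are the transverse conditions): from the isotropy of `TransverseIsotropyProofs` (trivial
local actions, `T` `p`-primary, `R` killed by an odd `N`, `Γ_{K_v} = ⋃_j σ₀^j (Γ_{K_v} ∩ Γ_{K[ℓ]})`, `φ_v` respecting the ring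
class group) and the count `#H¹_tr(K_v, T) · #H¹_tr(K_{σv}, T) = #H¹(K_v, T)` (Prop. 1.1.9).
[cite: Howard2004HeegnerKolyvagin, §1.3 H.4 (arXiv p. 7 L78–82), Prop. 1.1.9, Def. 1.2.2, Lemma 1.5.6 (p. 10 L86–88)] [cite: MilneADT2006, Ch. I Prop. 0.19 and Cor. 2.3] -/
theorem isSelfOrthogonalAt_of_transverse (hn : ∀ m : M, (p ^ k) • m = 0)
    (hΘ : Bijective (D.toTateDual lam hlam exp hexp)) (inv : LocalInvariants K (p ^ k)) (hperf : inv.IsPerfect)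
    (ℓ : ℕ) (jbar : AlgebraicClosure K →+* ℂ) (v : HeightOneSpectrum (𝓞 K)) (𝓣 : SelmerStructure ρ)
    (h𝓣v : 𝓣 (Sum.inr v) = transverseCondition p ρ ℓ jbar v)
    (h𝓣v' : 𝓣 (Sum.inr (cd.σ • v)) = transverseCondition p ρ ℓ jbar (cd.σ • v))
    (htriv : ∀ (g : absoluteGaloisGroup (v.adicCompletion K)) (x : M), GaloisRep.toLocal v ρ g x = x)
    (htriv' : ∀ (g : absoluteGaloisGroup ((cd.σ • v).adicCompletion K)) (x : M), GaloisRep.toLocal (cd.σ • v) ρ g x = x)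
    (htrivTw : ∀ (g : absoluteGaloisGroup (v.adicCompletion K)) (x : M), GaloisRep.toLocal v (cd.twist ρ) g x = x)
    (hp : ∀ x : M, ∃ n : ℕ, p ^ n • x = 0) {N : ℕ} (hN : Odd N) (hR : ∀ r : R, N • r = 0)
    (σ₀ : absoluteGaloisGroup (v.adicCompletion K))
    (hcyc : ∀ σ, ∃ j : ℕ, (σ₀ ^ j)⁻¹ * σ ∈ localRingClassSubgroup ℓ jbar v)
    (hφ : ∀ h ∈ localRingClassSubgroup ℓ jbar v, cd.φ v h ∈ localRingClassSubgroup ℓ jbar (cd.σ • v))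
    (hcard : Nat.card (𝓣 (Sum.inr v)) * Nat.card (𝓣 (Sum.inr (cd.σ • v))) =
      Nat.card (galoisCohomology (ρ.toLocal (Sum.inr v)) 1)) :
    D.IsSelfOrthogonalAt 𝓣 v :=
  D.isSelfOrthogonalAt_of_isotropic_of_card lam hlam exp hexp hn hΘ inv hperf 𝓣 v
    (D.forall_localCup_eq_zero_of_transverse ℓ jbar v 𝓣 h𝓣v h𝓣v' htriv htriv' htrivTw hp hN hR σ₀ hcyc hφ) hcard

/-! ## §3 Assembling H.4 for a modified structure (`𝓕(n)`: transverse at the primes of `n`, `𝓕` elsewhere) -/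

omit [Finite M] in
/-- `IsSelfOrthogonalAt 𝓕 v` depends only on the components of `𝓕` at `v` and `σ v`.
[cite: Howard2004HeegnerKolyvagin, §1.3 H.4 (arXiv p. 7 L78–82)] -/
theorem isSelfOrthogonalAt_congr {𝓕 𝓖 : SelmerStructure ρ} {v : HeightOneSpectrum (𝓞 K)}
    (h : 𝓕 (Sum.inr v) = 𝓖 (Sum.inr v)) (h' : 𝓕 (Sum.inr (cd.σ • v)) = 𝓖 (Sum.inr (cd.σ • v))) :
    D.IsSelfOrthogonalAt 𝓕 v ↔ D.IsSelfOrthogonalAt 𝓖 v := by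
  unfold IsSelfOrthogonalAt
  rw [h, h']

omit [Finite M] in
/-- **H.4 for `𝓕(n)` from H.4 for `𝓕` and H.4 at the modified primes.**  If `𝓖` agrees with `𝓕` at every finite place
outside a set `P` of finite places stable under `σ` (Howard: `P` = the primes of `n`, all inert), `𝓕` is self-orthogonal
at every finite place (H.4), and `𝓖` is self-orthogonal at the places of `P` (e.g. `isSelfOrthogonalAt_of_transverse`), then
`𝓖` is self-orthogonal at every finite place — the hypothesis `horth` of `RelaxedSelmerSelfAnnihilatorProofs` for `𝓕(n)`.
[cite: Howard2004HeegnerKolyvagin, §1.3 H.4 and Remark after Def. 1.2.2 / Lemma 1.5.6 (arXiv p. 10 L86–88: «`𝓕^m(n)` is maximal isotropic away from `m`»)] -/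
theorem isSelfOrthogonal_of_eq_off (𝓕 𝓖 : SelmerStructure ρ) (P : Set (HeightOneSpectrum (𝓞 K)))
    (hP : ∀ v ∈ P, cd.σ • v ∈ P) (hoff : ∀ v ∉ P, 𝓖 (Sum.inr v) = 𝓕 (Sum.inr v))
    (h𝓕 : D.IsSelfOrthogonal 𝓕) (h𝓖 : ∀ v ∈ P, D.IsSelfOrthogonalAt 𝓖 v) :
    D.IsSelfOrthogonal 𝓖 := fun v => by
  by_cases hv : v ∈ P
  · exact h𝓖 v hv
  · have hv' : cd.σ • v ∉ P := fun h => hv (by simpa only [cd.smul_smul_place] using hP _ h)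
    exact (D.isSelfOrthogonalAt_congr (hoff v hv).symm (hoff _ hv').symm).1 (h𝓕 v)

end DualityDatum

end Literature.NumberTheory.GaloisCohomology.Howard2004

end
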